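import Summits.NavierStokesRegularity.NavierStokesRegularity.Theses.HodographBetchov
import Summits.NavierStokesRegularity.NavierStokesRegularity.Theorems.HodographBetchovSlowClassProductionStubSlabProduction
import Summits.NavierStokesRegularity.NavierStokesRegularity.Theorems.HodographBetchovSlowClassProductionStubDeepSlowProduction

/-!
# `SlowClassProduction` (stmt-NavierStokesRegularity-15831) is EQUIVALENT to its collar budget

Route `HodographBetchov`, crux 2, line `birth` (registered skeleton
`Cruxes/SlowClassProduction/Lines/birth.lean`: parabolic trichotomy INITIAL / DEEP / COLLAR of the
slow class `S_t = {(s,x) : 0 < s < t, |u(s,x)| ≤ l}`).  Stubs 1 (`Birth.stub_slabProduction`,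
production `P = ⟪ω, ∇u ω⟫` is `L¹` on every sub-slab `(0,t₁) × ℝ³`, `t₁ < T`) and 2
(`Birth.stub_deepSlowProduction`, uniform absolute budget on the deep piece) are theorems of the tree.
This file turns the skeleton's composition into an importable theorem and proves the converse:

* `slowClassBudget_of_collarBudget` (per solution, level and admissible `(τ, r)`) — a COLLAR
  budget `∫_{S_t ∩ Collar(τ,r)} P ≤ C₂` for all `t < T` gives the slow-class budget (the skeleton's
  glue: split `S_t` along `{s < τ}` and along the closed proxy of the deep region, add the budgets);
* `collarBudget_of_slowClassBudget` — conversely a slow-class budget gives the collar budget for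
  EVERY admissible `(τ, r)` (collar = slow − initial − deep, the last two absolutely bounded);
* `slowClassProduction_iff_collarBudget` — the crux ⟺ the statement of stub 3
  `stub_collarProduction` (at `τ = T/2`, `r = min (ν/l) √(ν T/2)` for →).

So the line `birth` loses nothing: the open content of the crux is exactly the collar budget.
-/

noncomputable section

-- the summit and its single problem share the name `NavierStokesRegularity` (D-0017 nested layout)
set_option linter.dupNamespace false

namespace Summit.NavierStokesRegularity.NavierStokesRegularity.Theorems.SlowClassProduction

open Set MeasureTheory Function Metric Literature.Analysis.FluidPDE
open scoped ENNReal NNReal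

section Glue

variable {u : ℝ → EuclideanSpace ℝ (Fin 3) → EuclideanSpace ℝ (Fin 3)}

/-- The closed proxy `⋂_{σ ∈ [0,r²/ν], |η| ≤ r} {τ ≤ s ≤ t, |u(s−σ, x+η)| ≤ l}` of the deep region is
measurable when `u` is continuous on `[0,T) × ℝ³`, `r² ≤ ν τ` and `t < T`. -/
theorem measurableSet_deepProxy {ν l τ r t T : ℝ} (hν : 0 < ν) (hrτ : r ^ 2 ≤ ν * τ) (htT : t < T)
    (hU : ContinuousOn (Function.uncurry u)
      (Set.Ico 0 T ×ˢ (Set.univ : Set (EuclideanSpace ℝ (Fin 3))))) :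
    MeasurableSet (⋂ σ ∈ Set.Icc (0 : ℝ) (r ^ 2 / ν),
      ⋂ η ∈ Metric.closedBall (0 : EuclideanSpace ℝ (Fin 3)) r,
        ({z : ℝ × EuclideanSpace ℝ (Fin 3) | z.1 ∈ Set.Icc τ t} ∩
          (fun z : ℝ × EuclideanSpace ℝ (Fin 3) => u (z.1 - σ) (z.2 + η)) ⁻¹'
            Metric.closedBall (0 : EuclideanSpace ℝ (Fin 3)) l)) := by
  -- adapted from Cruxes/SlowClassProduction/Lines/birth.lean (planner glue)
  refine IsClosed.measurableSet ?_
  refine isClosed_biInter fun σ hσ => isClosed_biInter fun η _ => ?_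
  refine ContinuousOn.preimage_isClosed_of_isClosed ?_ (isClosed_Icc.preimage continuous_fst)
    Metric.isClosed_closedBall
  have hg : Continuous fun z : ℝ × EuclideanSpace ℝ (Fin 3) =>
      ((z.1 - σ, z.2 + η) : ℝ × EuclideanSpace ℝ (Fin 3)) :=
    (continuous_fst.sub continuous_const).prodMk (continuous_snd.add continuous_const)
  have hστ : r ^ 2 / ν ≤ τ := by
    rw [div_le_iff₀ hν]
    linarith
  refine hU.comp hg.continuousOn fun z hz => Set.mk_mem_prod ⟨?_, ?_⟩ (Set.mem_univ _)
  · linarith [hσ.2, hz.1]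
  · linarith [hσ.1, hz.2]

/-- Beyond the delay, the proxy cuts the DEEP piece out of the slow class. -/
theorem slow_sdiff_inter_deepProxy {ν l τ r t : ℝ} :
    ({z : ℝ × EuclideanSpace ℝ (Fin 3) | z.1 ∈ Set.Ioo 0 t ∧ ‖u z.1 z.2‖ ≤ l} \
        {z : ℝ × EuclideanSpace ℝ (Fin 3) | z.1 < τ}) ∩
      (⋂ σ ∈ Set.Icc (0 : ℝ) (r ^ 2 / ν), ⋂ η ∈ Metric.closedBall (0 : EuclideanSpace ℝ (Fin 3)) r,
        ({z : ℝ × EuclideanSpace ℝ (Fin 3) | z.1 ∈ Set.Icc τ t} ∩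
          (fun z : ℝ × EuclideanSpace ℝ (Fin 3) => u (z.1 - σ) (z.2 + η)) ⁻¹'
            Metric.closedBall (0 : EuclideanSpace ℝ (Fin 3)) l)) =
    {z : ℝ × EuclideanSpace ℝ (Fin 3) | z.1 ∈ Set.Ioo 0 t ∧ ‖u z.1 z.2‖ ≤ l} ∩
      {z : ℝ × EuclideanSpace ℝ (Fin 3) | τ ≤ z.1 ∧
        ∀ s ∈ Set.Icc (z.1 - r ^ 2 / ν) z.1, ∀ y ∈ Metric.closedBall z.2 r, ‖u s y‖ ≤ l} := by
  -- adapted from Cruxes/SlowClassProduction/Lines/birth.lean (planner glue)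
  ext z
  simp only [Set.mem_inter_iff, Set.mem_sdiff, Set.mem_setOf_eq, Set.mem_iInter, Set.mem_preimage,
    Metric.mem_closedBall, dist_zero_right, not_lt, Set.mem_Icc, Set.mem_Ioo]
  constructor
  · rintro ⟨⟨⟨hzt, hzl⟩, hτz⟩, hM⟩
    refine ⟨⟨hzt, hzl⟩, hτz, fun s hs y hy => ?_⟩
    have hy' : ‖y - z.2‖ ≤ r := by rwa [← dist_eq_norm]
    have h := hM (z.1 - s) ⟨by linarith [hs.2], by linarith [hs.1]⟩ (y - z.2) hy'
    simpa [sub_sub_cancel, add_sub_cancel] using h.2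
  · rintro ⟨⟨hzt, hzl⟩, hτz, hD⟩
    refine ⟨⟨⟨hzt, hzl⟩, hτz⟩, fun σ hσ η hη => ⟨⟨hτz, hzt.2.le⟩, ?_⟩⟩
    refine hD (z.1 - σ) ⟨by linarith [hσ.2], by linarith [hσ.1]⟩ (z.2 + η) ?_
    simpa [dist_eq_norm] using hη

/-- Beyond the delay, the complement of the proxy is the COLLAR piece of the slow class. -/
theorem slow_sdiff_sdiff_deepProxy {ν l τ r t : ℝ} :
    ({z : ℝ × EuclideanSpace ℝ (Fin 3) | z.1 ∈ Set.Ioo 0 t ∧ ‖u z.1 z.2‖ ≤ l} \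
        {z : ℝ × EuclideanSpace ℝ (Fin 3) | z.1 < τ}) \
      (⋂ σ ∈ Set.Icc (0 : ℝ) (r ^ 2 / ν), ⋂ η ∈ Metric.closedBall (0 : EuclideanSpace ℝ (Fin 3)) r,
        ({z : ℝ × EuclideanSpace ℝ (Fin 3) | z.1 ∈ Set.Icc τ t} ∩
          (fun z : ℝ × EuclideanSpace ℝ (Fin 3) => u (z.1 - σ) (z.2 + η)) ⁻¹'
            Metric.closedBall (0 : EuclideanSpace ℝ (Fin 3)) l)) =
    {z : ℝ × EuclideanSpace ℝ (Fin 3) | z.1 ∈ Set.Ioo 0 t ∧ ‖u z.1 z.2‖ ≤ l} ∩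
      {z : ℝ × EuclideanSpace ℝ (Fin 3) | τ ≤ z.1 ∧
        ∃ s ∈ Set.Icc (z.1 - r ^ 2 / ν) z.1, ∃ y ∈ Metric.closedBall z.2 r, l < ‖u s y‖} := by
  -- adapted from Cruxes/SlowClassProduction/Lines/birth.lean (planner glue)
  ext z
  simp only [Set.mem_inter_iff, Set.mem_sdiff, Set.mem_setOf_eq, Set.mem_iInter, Set.mem_preimage,
    Metric.mem_closedBall, dist_zero_right, not_lt, Set.mem_Icc, Set.mem_Ioo]
  constructor
  · rintro ⟨⟨⟨hzt, hzl⟩, hτz⟩, hM⟩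
    push Not at hM
    obtain ⟨σ, hσ, η, hη, hfast⟩ := hM
    refine ⟨⟨hzt, hzl⟩, hτz, z.1 - σ, ⟨by linarith [hσ.2], by linarith [hσ.1]⟩, z.2 + η, ?_, ?_⟩
    · simpa [dist_eq_norm] using hη
    · exact hfast ⟨hτz, hzt.2.le⟩
  · rintro ⟨⟨hzt, hzl⟩, hτz, s, hs, y, hy, hfast⟩
    refine ⟨⟨⟨hzt, hzl⟩, hτz⟩, fun hM => ?_⟩
    have hy' : ‖y - z.2‖ ≤ r := by rwa [← dist_eq_norm]
    have h := hM (z.1 - s) ⟨by linarith [hs.2], by linarith [hs.1]⟩ (y - z.2) hy'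
    have h2 : ‖u s y‖ ≤ l := by simpa [sub_sub_cancel, add_sub_cancel] using h.2
    exact absurd h2 (not_le.mpr hfast)

/-- **Three-piece decomposition of the slow-class integral.**  For `u` continuous on `[0,T) × ℝ³`,
`0 < τ`, `r² ≤ ν τ`, `t < T`, and `P` integrable on the slow class `S_t`, the slow-class integral
splits as INITIAL + DEEP + COLLAR:
`∫_{S_t} P = ∫_{S_t ∩ {s<τ}} P + ∫_{S_t ∩ Deep} P + ∫_{S_t ∩ Collar} P`
(`integral_inter_add_sdiff` along the measurable cut `{s < τ}` and along the closed proxy). -/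
theorem setIntegral_slow_eq_three_pieces {ν l τ r t T : ℝ} (hν : 0 < ν) (hrτ : r ^ 2 ≤ ν * τ)
    (htT : t < T)
    (hU : ContinuousOn (Function.uncurry u)
      (Set.Ico 0 T ×ˢ (Set.univ : Set (EuclideanSpace ℝ (Fin 3)))))
    {P : ℝ × EuclideanSpace ℝ (Fin 3) → ℝ}
    (hS : MeasureTheory.IntegrableOn P
      {z : ℝ × EuclideanSpace ℝ (Fin 3) | z.1 ∈ Set.Ioo 0 t ∧ ‖u z.1 z.2‖ ≤ l}) :
    ∫ z in {z : ℝ × EuclideanSpace ℝ (Fin 3) | z.1 ∈ Set.Ioo 0 t ∧ ‖u z.1 z.2‖ ≤ l}, P z =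
      (∫ z in {z : ℝ × EuclideanSpace ℝ (Fin 3) | z.1 ∈ Set.Ioo 0 t ∧ ‖u z.1 z.2‖ ≤ l} ∩
          {z : ℝ × EuclideanSpace ℝ (Fin 3) | z.1 < τ}, P z) +
      (∫ z in {z : ℝ × EuclideanSpace ℝ (Fin 3) | z.1 ∈ Set.Ioo 0 t ∧ ‖u z.1 z.2‖ ≤ l} ∩
          {z : ℝ × EuclideanSpace ℝ (Fin 3) | τ ≤ z.1 ∧
            ∀ s ∈ Set.Icc (z.1 - r ^ 2 / ν) z.1, ∀ y ∈ Metric.closedBall z.2 r, ‖u s y‖ ≤ l}, P z) +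
      (∫ z in {z : ℝ × EuclideanSpace ℝ (Fin 3) | z.1 ∈ Set.Ioo 0 t ∧ ‖u z.1 z.2‖ ≤ l} ∩
          {z : ℝ × EuclideanSpace ℝ (Fin 3) | τ ≤ z.1 ∧
            ∃ s ∈ Set.Icc (z.1 - r ^ 2 / ν) z.1, ∃ y ∈ Metric.closedBall z.2 r, l < ‖u s y‖}, P z) := by
  have hA : MeasurableSet {z : ℝ × EuclideanSpace ℝ (Fin 3) | z.1 < τ} :=
    measurableSet_lt measurable_fst measurable_const
  have hM := measurableSet_deepProxy (u := u) (l := l) hν hrτ htT hU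
  have e1 := integral_inter_add_sdiff hA hS
  have e2 := integral_inter_add_sdiff hM
    (hS.mono_set (Set.sdiff_subset (t := {z : ℝ × EuclideanSpace ℝ (Fin 3) | z.1 < τ})))
  rw [slow_sdiff_inter_deepProxy, slow_sdiff_sdiff_deepProxy] at e2
  rw [← e1, ← e2, add_assoc]

end Glue

section PerSolution

variable {ν T : ℝ} {u : ℝ → EuclideanSpace ℝ (Fin 3) → EuclideanSpace ℝ (Fin 3)}
  {p : ℝ → EuclideanSpace ℝ (Fin 3) → ℝ}

/-- **Collar budget ⇒ slow-class budget, per solution and level** (the composition of the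
registered skeleton `Lines/birth.lean`, with stubs 1–2 the tree theorems `Birth.stub_slabProduction`,
`Birth.stub_deepSlowProduction`).  For a classical Leray–Hopf solution from a rapidly decaying datum
on `[0,T)`, a level `l > 0` and admissible `(τ, r)` (`0 < τ < T`, `0 < r ≤ ν/l`, `r² ≤ ν τ`): if `C₂`
bounds the production on the COLLAR piece of the slow class for all `t < T`, then the slow-class
budget holds at `l` with `C = ∫∫_{(0,τ)×ℝ³} |P| + C₁ + C₂` (initial + deep + collar). -/
theorem slowClassBudget_of_collarBudget (hν : 0 < ν) (hT : 0 < T)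
    (hcl : Literature.Analysis.FluidPDE.IsClassicalNSSolutionOn (Set.Ico 0 T) ν 0 u p)
    (hLH : Literature.Analysis.FluidPDE.IsLerayHopfOn T ν 0 (u 0) u)
    (hdec : Literature.Analysis.FluidPDE.HasRapidSpatialDecay (u 0)) {l : ℝ} (hl : 0 < l)
    {τ r : ℝ} (hτ0 : 0 < τ) (hτT : τ < T) (hr0 : 0 < r) (hrl : r ≤ ν / l) (hrτ : r ^ 2 ≤ ν * τ)
    {C₂ : ℝ} (hK : ∀ t ∈ Set.Ico 0 T,
      MeasureTheory.IntegrableOn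
        (fun z : ℝ × EuclideanSpace ℝ (Fin 3) =>
          inner ℝ (Literature.Analysis.FluidPDE.curl (u z.1) z.2)
            (fderiv ℝ (u z.1) z.2 (Literature.Analysis.FluidPDE.curl (u z.1) z.2)))
        ({z : ℝ × EuclideanSpace ℝ (Fin 3) | z.1 ∈ Set.Ioo 0 t ∧ ‖u z.1 z.2‖ ≤ l} ∩
          {z : ℝ × EuclideanSpace ℝ (Fin 3) | τ ≤ z.1 ∧
            ∃ s ∈ Set.Icc (z.1 - r ^ 2 / ν) z.1, ∃ y ∈ Metric.closedBall z.2 r, l < ‖u s y‖}) ∧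
      ∫ z in ({z : ℝ × EuclideanSpace ℝ (Fin 3) | z.1 ∈ Set.Ioo 0 t ∧ ‖u z.1 z.2‖ ≤ l} ∩
          {z : ℝ × EuclideanSpace ℝ (Fin 3) | τ ≤ z.1 ∧
            ∃ s ∈ Set.Icc (z.1 - r ^ 2 / ν) z.1, ∃ y ∈ Metric.closedBall z.2 r, l < ‖u s y‖}),
        inner ℝ (Literature.Analysis.FluidPDE.curl (u z.1) z.2)
          (fderiv ℝ (u z.1) z.2 (Literature.Analysis.FluidPDE.curl (u z.1) z.2)) ≤ C₂) :
    ∃ C : ℝ, ∀ t ∈ Set.Ico 0 T,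
      MeasureTheory.IntegrableOn
        (fun z : ℝ × EuclideanSpace ℝ (Fin 3) =>
          inner ℝ (Literature.Analysis.FluidPDE.curl (u z.1) z.2)
            (fderiv ℝ (u z.1) z.2 (Literature.Analysis.FluidPDE.curl (u z.1) z.2)))
        {z : ℝ × EuclideanSpace ℝ (Fin 3) | z.1 ∈ Set.Ioo 0 t ∧ ‖u z.1 z.2‖ ≤ l} ∧
      ∫ z in {z : ℝ × EuclideanSpace ℝ (Fin 3) | z.1 ∈ Set.Ioo 0 t ∧ ‖u z.1 z.2‖ ≤ l},
        inner ℝ (Literature.Analysis.FluidPDE.curl (u z.1) z.2)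
          (fderiv ℝ (u z.1) z.2 (Literature.Analysis.FluidPDE.curl (u z.1) z.2)) ≤ C := by
  -- adapted from Cruxes/SlowClassProduction/Lines/birth.lean (`SlowClassProduction_of_stubs`)
  obtain ⟨C₁, hD⟩ := Birth.stub_deepSlowProduction ν T hν hT u p hcl hLH hdec l hl τ hτ0 hτT r hr0 hrl hrτ
  set P : ℝ × EuclideanSpace ℝ (Fin 3) → ℝ :=
    fun z => inner ℝ (curl (u z.1) z.2) (fderiv ℝ (u z.1) z.2 (curl (u z.1) z.2)) with hP_def
  have hI : IntegrableOn P (Set.Ioo 0 τ ×ˢ (Set.univ : Set (EuclideanSpace ℝ (Fin 3)))) :=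
    Birth.stub_slabProduction ν T hν hT u p hcl hLH hdec τ hτ0 hτT
  refine ⟨(∫ z in Set.Ioo 0 τ ×ˢ (Set.univ : Set (EuclideanSpace ℝ (Fin 3))), |P z|) + C₁ + C₂, ?_⟩
  intro t ht
  have hU : ContinuousOn (Function.uncurry u)
      (Set.Ico 0 T ×ˢ (Set.univ : Set (EuclideanSpace ℝ (Fin 3)))) :=
    hcl.smooth_velocity.continuousOn
  have hDt := hD t ht
  have hKt := hK t ht
  -- the initial piece sits in the slab `(0,τ) × ℝ³`
  have hsub : {z : ℝ × EuclideanSpace ℝ (Fin 3) | z.1 ∈ Set.Ioo 0 t ∧ ‖u z.1 z.2‖ ≤ l} ∩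
      {z : ℝ × EuclideanSpace ℝ (Fin 3) | z.1 < τ} ⊆
      Set.Ioo 0 τ ×ˢ (Set.univ : Set (EuclideanSpace ℝ (Fin 3))) := by
    rintro z ⟨⟨hzt, _⟩, hzτ⟩
    exact Set.mk_mem_prod ⟨hzt.1, hzτ⟩ (Set.mem_univ _)
  have hIA := hI.mono_set hsub
  -- integrability on the whole slow class: initial ∪ (deep ∪ collar)
  have hS : IntegrableOn P {z : ℝ × EuclideanSpace ℝ (Fin 3) | z.1 ∈ Set.Ioo 0 t ∧ ‖u z.1 z.2‖ ≤ l} := by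
    have hfar : IntegrableOn P ({z : ℝ × EuclideanSpace ℝ (Fin 3) | z.1 ∈ Set.Ioo 0 t ∧ ‖u z.1 z.2‖ ≤ l} \
        {z : ℝ × EuclideanSpace ℝ (Fin 3) | z.1 < τ}) := by
      rw [← Set.inter_union_sdiff ({z : ℝ × EuclideanSpace ℝ (Fin 3) | z.1 ∈ Set.Ioo 0 t ∧ ‖u z.1 z.2‖ ≤ l} \
          {z : ℝ × EuclideanSpace ℝ (Fin 3) | z.1 < τ})
        (⋂ σ ∈ Set.Icc (0 : ℝ) (r ^ 2 / ν), ⋂ η ∈ Metric.closedBall (0 : EuclideanSpace ℝ (Fin 3)) r,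
          ({z : ℝ × EuclideanSpace ℝ (Fin 3) | z.1 ∈ Set.Icc τ t} ∩
            (fun z : ℝ × EuclideanSpace ℝ (Fin 3) => u (z.1 - σ) (z.2 + η)) ⁻¹'
              Metric.closedBall (0 : EuclideanSpace ℝ (Fin 3)) l)),
        slow_sdiff_inter_deepProxy, slow_sdiff_sdiff_deepProxy]
      exact hDt.1.union hKt.1
    rw [← Set.inter_union_sdiff {z : ℝ × EuclideanSpace ℝ (Fin 3) | z.1 ∈ Set.Ioo 0 t ∧ ‖u z.1 z.2‖ ≤ l}
      {z : ℝ × EuclideanSpace ℝ (Fin 3) | z.1 < τ}]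
    exact hIA.union hfar
  refine ⟨hS, ?_⟩
  rw [setIntegral_slow_eq_three_pieces hν hrτ ht.2 hU hS]
  have b0 : ∫ z in {z : ℝ × EuclideanSpace ℝ (Fin 3) | z.1 ∈ Set.Ioo 0 t ∧ ‖u z.1 z.2‖ ≤ l} ∩
      {z : ℝ × EuclideanSpace ℝ (Fin 3) | z.1 < τ}, P z ≤
      ∫ z in Set.Ioo 0 τ ×ˢ (Set.univ : Set (EuclideanSpace ℝ (Fin 3))), |P z| :=
    (integral_mono hIA hIA.abs fun z => le_abs_self _).trans
      (setIntegral_mono_set hI.abs (ae_of_all _ fun z => abs_nonneg _) hsub.eventuallyLE)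
  have b1 := (integral_mono hDt.1 hDt.1.abs fun z => le_abs_self _).trans hDt.2
  linarith [hKt.2]

/-- **Slow-class budget ⇒ collar budget, per solution, level and admissible `(τ, r)`.**  The
collar integral is the slow-class integral minus the initial and deep pieces
(`setIntegral_slow_eq_three_pieces`), which are absolutely bounded by stubs 1–2; so a slow-class
budget `C` at level `l` gives the collar budget `C + ∫∫_{(0,τ)×ℝ³}|P| + C₁` for EVERY admissible
`(τ, r)`. -/
theorem collarBudget_of_slowClassBudget (hν : 0 < ν) (hT : 0 < T)
    (hcl : Literature.Analysis.FluidPDE.IsClassicalNSSolutionOn (Set.Ico 0 T) ν 0 u p)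
    (hLH : Literature.Analysis.FluidPDE.IsLerayHopfOn T ν 0 (u 0) u)
    (hdec : Literature.Analysis.FluidPDE.HasRapidSpatialDecay (u 0)) {l : ℝ} (hl : 0 < l)
    {τ r : ℝ} (hτ0 : 0 < τ) (hτT : τ < T) (hr0 : 0 < r) (hrl : r ≤ ν / l) (hrτ : r ^ 2 ≤ ν * τ)
    {C : ℝ} (hC : ∀ t ∈ Set.Ico 0 T,
      MeasureTheory.IntegrableOn
        (fun z : ℝ × EuclideanSpace ℝ (Fin 3) =>
          inner ℝ (Literature.Analysis.FluidPDE.curl (u z.1) z.2)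
            (fderiv ℝ (u z.1) z.2 (Literature.Analysis.FluidPDE.curl (u z.1) z.2)))
        {z : ℝ × EuclideanSpace ℝ (Fin 3) | z.1 ∈ Set.Ioo 0 t ∧ ‖u z.1 z.2‖ ≤ l} ∧
      ∫ z in {z : ℝ × EuclideanSpace ℝ (Fin 3) | z.1 ∈ Set.Ioo 0 t ∧ ‖u z.1 z.2‖ ≤ l},
        inner ℝ (Literature.Analysis.FluidPDE.curl (u z.1) z.2)
          (fderiv ℝ (u z.1) z.2 (Literature.Analysis.FluidPDE.curl (u z.1) z.2)) ≤ C) :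
    ∃ C' : ℝ, ∀ t ∈ Set.Ico 0 T,
      MeasureTheory.IntegrableOn
        (fun z : ℝ × EuclideanSpace ℝ (Fin 3) =>
          inner ℝ (Literature.Analysis.FluidPDE.curl (u z.1) z.2)
            (fderiv ℝ (u z.1) z.2 (Literature.Analysis.FluidPDE.curl (u z.1) z.2)))
        ({z : ℝ × EuclideanSpace ℝ (Fin 3) | z.1 ∈ Set.Ioo 0 t ∧ ‖u z.1 z.2‖ ≤ l} ∩
          {z : ℝ × EuclideanSpace ℝ (Fin 3) | τ ≤ z.1 ∧
            ∃ s ∈ Set.Icc (z.1 - r ^ 2 / ν) z.1, ∃ y ∈ Metric.closedBall z.2 r, l < ‖u s y‖}) ∧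
      ∫ z in ({z : ℝ × EuclideanSpace ℝ (Fin 3) | z.1 ∈ Set.Ioo 0 t ∧ ‖u z.1 z.2‖ ≤ l} ∩
          {z : ℝ × EuclideanSpace ℝ (Fin 3) | τ ≤ z.1 ∧
            ∃ s ∈ Set.Icc (z.1 - r ^ 2 / ν) z.1, ∃ y ∈ Metric.closedBall z.2 r, l < ‖u s y‖}),
        inner ℝ (Literature.Analysis.FluidPDE.curl (u z.1) z.2)
          (fderiv ℝ (u z.1) z.2 (Literature.Analysis.FluidPDE.curl (u z.1) z.2)) ≤ C' := by
  obtain ⟨C₁, hD⟩ := Birth.stub_deepSlowProduction ν T hν hT u p hcl hLH hdec l hl τ hτ0 hτT r hr0 hrl hrτ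
  set P : ℝ × EuclideanSpace ℝ (Fin 3) → ℝ :=
    fun z => inner ℝ (curl (u z.1) z.2) (fderiv ℝ (u z.1) z.2 (curl (u z.1) z.2)) with hP_def
  have hI : IntegrableOn P (Set.Ioo 0 τ ×ˢ (Set.univ : Set (EuclideanSpace ℝ (Fin 3)))) :=
    Birth.stub_slabProduction ν T hν hT u p hcl hLH hdec τ hτ0 hτT
  refine ⟨C + (∫ z in Set.Ioo 0 τ ×ˢ (Set.univ : Set (EuclideanSpace ℝ (Fin 3))), |P z|) + C₁, ?_⟩
  intro t ht
  have hU : ContinuousOn (Function.uncurry u)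
      (Set.Ico 0 T ×ˢ (Set.univ : Set (EuclideanSpace ℝ (Fin 3)))) :=
    hcl.smooth_velocity.continuousOn
  obtain ⟨hSt, hCt⟩ := hC t ht
  have hDt := hD t ht
  refine ⟨hSt.mono_set Set.inter_subset_left, ?_⟩
  have e := setIntegral_slow_eq_three_pieces hν hrτ ht.2 hU hSt
  have hsub : {z : ℝ × EuclideanSpace ℝ (Fin 3) | z.1 ∈ Set.Ioo 0 t ∧ ‖u z.1 z.2‖ ≤ l} ∩
      {z : ℝ × EuclideanSpace ℝ (Fin 3) | z.1 < τ} ⊆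
      Set.Ioo 0 τ ×ˢ (Set.univ : Set (EuclideanSpace ℝ (Fin 3))) := by
    rintro z ⟨⟨hzt, _⟩, hzτ⟩
    exact Set.mk_mem_prod ⟨hzt.1, hzτ⟩ (Set.mem_univ _)
  have b0 : -(∫ z in Set.Ioo 0 τ ×ˢ (Set.univ : Set (EuclideanSpace ℝ (Fin 3))), |P z|) ≤
      ∫ z in {z : ℝ × EuclideanSpace ℝ (Fin 3) | z.1 ∈ Set.Ioo 0 t ∧ ‖u z.1 z.2‖ ≤ l} ∩
        {z : ℝ × EuclideanSpace ℝ (Fin 3) | z.1 < τ}, P z :=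
    (abs_le.1 ((abs_integral_le_integral_abs (f := P)).trans
      (setIntegral_mono_set hI.abs (ae_of_all _ fun z => abs_nonneg _) hsub.eventuallyLE))).1
  have b1 : -C₁ ≤ ∫ z in {z : ℝ × EuclideanSpace ℝ (Fin 3) | z.1 ∈ Set.Ioo 0 t ∧ ‖u z.1 z.2‖ ≤ l} ∩
      {z : ℝ × EuclideanSpace ℝ (Fin 3) | τ ≤ z.1 ∧
        ∀ s ∈ Set.Icc (z.1 - r ^ 2 / ν) z.1, ∀ y ∈ Metric.closedBall z.2 r, ‖u s y‖ ≤ l}, P z :=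
    (abs_le.1 ((abs_integral_le_integral_abs (f := P)).trans hDt.2)).1
  linarith

end PerSolution

/-- **`SlowClassProduction` is equivalent to the collar budget** — the statement of stub 3
`stub_collarProduction` of line `birth`: for every classical Leray–Hopf solution from a rapidly
decaying datum on `[0,T)` and every level `l > 0`, SOME admissible `(τ, r)` and `C` bound the
production on the COLLAR piece of the slow class (`τ ≤ s < t`, `|u(s,x)| ≤ l`, a fast point
`|u| > l` in the backward cylinder `[s − r²/ν, s] × B̄(x,r)`) uniformly in `t < T`.  (→) uses
`collarBudget_of_slowClassBudget` at `τ = T/2`, `r = min (ν/l) √(ν T/2)`; (←) is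
`slowClassBudget_of_collarBudget`.  The open content of the crux is exactly the collar. -/
theorem slowClassProduction_iff_collarBudget :
    Summit.NavierStokesRegularity.NavierStokesRegularity.Theses.HodographBetchov.SlowClassProduction ↔
    ∀ (ν T : ℝ), 0 < ν → 0 < T →
      ∀ (u : ℝ → EuclideanSpace ℝ (Fin 3) → EuclideanSpace ℝ (Fin 3))
        (p : ℝ → EuclideanSpace ℝ (Fin 3) → ℝ),
        Literature.Analysis.FluidPDE.IsClassicalNSSolutionOn (Set.Ico 0 T) ν 0 u p →
        Literature.Analysis.FluidPDE.IsLerayHopfOn T ν 0 (u 0) u →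
        Literature.Analysis.FluidPDE.HasRapidSpatialDecay (u 0) →
        ∀ l : ℝ, 0 < l → ∃ τ : ℝ, 0 < τ ∧ τ < T ∧ ∃ r : ℝ, 0 < r ∧ r ≤ ν / l ∧ r ^ 2 ≤ ν * τ ∧
          ∃ C : ℝ, ∀ t ∈ Set.Ico 0 T,
            MeasureTheory.IntegrableOn
              (fun z : ℝ × EuclideanSpace ℝ (Fin 3) =>
                inner ℝ (Literature.Analysis.FluidPDE.curl (u z.1) z.2)
                  (fderiv ℝ (u z.1) z.2 (Literature.Analysis.FluidPDE.curl (u z.1) z.2)))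
              ({z : ℝ × EuclideanSpace ℝ (Fin 3) | z.1 ∈ Set.Ioo 0 t ∧ ‖u z.1 z.2‖ ≤ l} ∩
                {z : ℝ × EuclideanSpace ℝ (Fin 3) | τ ≤ z.1 ∧
                  ∃ s ∈ Set.Icc (z.1 - r ^ 2 / ν) z.1, ∃ y ∈ Metric.closedBall z.2 r,
                    l < ‖u s y‖}) ∧
            ∫ z in ({z : ℝ × EuclideanSpace ℝ (Fin 3) | z.1 ∈ Set.Ioo 0 t ∧ ‖u z.1 z.2‖ ≤ l} ∩
                {z : ℝ × EuclideanSpace ℝ (Fin 3) | τ ≤ z.1 ∧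
                  ∃ s ∈ Set.Icc (z.1 - r ^ 2 / ν) z.1, ∃ y ∈ Metric.closedBall z.2 r,
                    l < ‖u s y‖}),
              inner ℝ (Literature.Analysis.FluidPDE.curl (u z.1) z.2)
                (fderiv ℝ (u z.1) z.2 (Literature.Analysis.FluidPDE.curl (u z.1) z.2)) ≤ C := by
  unfold Summit.NavierStokesRegularity.NavierStokesRegularity.Theses.HodographBetchov.SlowClassProduction
  constructor
  · intro hS ν T hν hT u p hcl hLH hdec l hl
    set τ : ℝ := T / 2 with hτ_def
    have hτ0 : 0 < τ := by rw [hτ_def]; linarith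
    have hτT : τ < T := by rw [hτ_def]; linarith
    set r : ℝ := min (ν / l) (Real.sqrt (ν * τ)) with hr_def
    have hr0 : 0 < r := lt_min (div_pos hν hl) (Real.sqrt_pos.2 (mul_pos hν hτ0))
    have hrl : r ≤ ν / l := min_le_left _ _
    have hrτ : r ^ 2 ≤ ν * τ := by
      calc r ^ 2 ≤ (Real.sqrt (ν * τ)) ^ 2 := pow_le_pow_left₀ hr0.le (min_le_right _ _) 2
        _ = ν * τ := Real.sq_sqrt (mul_pos hν hτ0).le
    obtain ⟨C, hC⟩ := hS ν T hν hT u p hcl hLH hdec l hl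
    exact ⟨τ, hτ0, hτT, r, hr0, hrl, hrτ,
      collarBudget_of_slowClassBudget hν hT hcl hLH hdec hl hτ0 hτT hr0 hrl hrτ hC⟩
  · intro h₃ ν T hν hT u p hcl hLH hdec l hl
    obtain ⟨τ, hτ0, hτT, r, hr0, hrl, hrτ, C₂, hK⟩ := h₃ ν T hν hT u p hcl hLH hdec l hl
    exact slowClassBudget_of_collarBudget hν hT hcl hLH hdec hl hτ0 hτT hr0 hrl hrτ hK

end Summit.NavierStokesRegularity.NavierStokesRegularity.Theorems.SlowClassProduction

end
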